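import Summits.Ventures.PercRepro.S2ContractionLever
import Summits.Ventures.PercRepro.S2ContractionCaps

/-!
# PercRepro — S2: THE NULLITY BUDGET OF A COLOOP-FREE MATROID AND THE COUNTS THROUGH ONE DELETION (p7, gen 18; sub-claim S2;
the tools of the case `ν = 4` of the cells `(13, 8 …)`)

For a finite matroid `N` of dual rank `ν`: **`encard_add_one_le_eRk_add_of_not_isColoop`** — a set `A` missing a non-coloop `e` has
`|A| + 1 ≤ ρ(A) + ν` (its nullity is at most `ν − 1`: `E ∖ e` spans). **`exists_forall_indep_pair`** — a loopless matroid with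
`|E| < 2·ρ(E)` has an element in no `2`-circuit (every basis element with a parallel partner outside the basis would make the
complement of the basis spanning). **`eRank_dual_delete_singleton`** / **`eRank_dual_contract_singleton`** — deleting a non-coloop
lowers the dual rank by one, contracting a non-loop keeps it. **`encard_le_eRk_add_of_dual_eRank`** — the nullity of
a subset is at most `ν`. **`ncard_dep_two_le_of_forall_indep_pair`** — the dependent pairs avoid such an `e`, so they are the dependent
pairs of `N ＼ e`, at most `C(ν + 1, 2)` when `N✶.eRank = ν + 1` (the kit); **`ncard_dep_three_le_of_forall_indep_pair`** — the dependent
triples avoiding `e` are those of `N ＼ e`, those through `e` are `e` plus a dependent pair or `3`-circuits through `e`, which inject into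
the `2`-circuits of `N ／ e`. The counts of a simple matroid are in S2NuFourSimpleCounts. Nothing about any cell is claimed. Axioms: standard.
-/

open scoped Matroid

namespace PercRepro

namespace S2

open Set

variable {α : Type}

/-- **The nullity budget of a coloop-free matroid**: if `e ∉ A` is not a coloop, `|A| + 1 ≤ ρ(A) + ν`. -/
theorem encard_add_one_le_eRk_add_of_not_isColoop (N : Matroid α) [N.Finite] {ν : ℕ} (hν : N✶.eRank = (ν : ℕ∞))
    {A : Set α} (hA : A ⊆ N.E) {e : α} (he : e ∈ N.E) (heA : e ∉ A) (hec : ¬ N.IsColoop e) :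
    A.encard + 1 ≤ N.eRk A + ν := by
  have hY : A ⊆ N.E \ {e} := Set.subset_sdiff_singleton hA heA
  have hsp : N.Spanning (N.E \ {e}) := by
    by_contra h
    exact hec (Matroid.isColoop_iff_sdiff_not_spanning.2 h)
  have h1 : N.eRk (N.E \ {e}) = N.eRank := hsp.eRk_eq
  have h2 : N.eRk (N.E \ {e}) ≤ N.eRk A + ((N.E \ {e}) \ A).encard := by
    calc N.eRk (N.E \ {e}) = N.eRk (A ∪ ((N.E \ {e}) \ A)) := by rw [Set.union_sdiff_cancel hY]
      _ ≤ N.eRk A + ((N.E \ {e}) \ A).encard := N.eRk_union_le_eRk_add_encard _ _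
  have h3 : ((N.E \ {e}) \ A).encard + A.encard = (N.E \ {e}).encard := Set.encard_sdiff_add_encard_of_subset hY
  have h4 : (N.E \ {e}).encard + 1 = N.E.encard := Set.encard_sdiff_singleton_add_one he
  have h5 : N.eRank + N✶.eRank = N.E.encard := N.eRank_add_eRank_dual
  have hRfin : N.eRank ≠ ⊤ := (N.eRank_le_encard_ground.trans_lt N.ground_finite.encard_lt_top).ne
  have key : A.encard + 1 + N.eRank ≤ N.eRk A + ν + N.eRank := by
    calc A.encard + 1 + N.eRank = A.encard + N.eRk (N.E \ {e}) + 1 := by rw [h1]; ring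
      _ ≤ A.encard + (N.eRk A + ((N.E \ {e}) \ A).encard) + 1 := by gcongr
      _ = N.eRk A + (((N.E \ {e}) \ A).encard + A.encard) + 1 := by ring
      _ = N.eRk A + ((N.E \ {e}).encard + 1) := by rw [h3]; ring
      _ = N.eRk A + (N.eRank + N✶.eRank) := by rw [h4, h5]
      _ = N.eRk A + ν + N.eRank := by rw [hν]; ring
  exact (ENat.add_le_add_iff_right hRfin).1 key

/-- **An element in no `2`-circuit**: a loopless finite matroid with `|E| < 2·ρ(E)` has one. -/
theorem exists_forall_indep_pair (N : Matroid α) [N.Finite] (hL : ∀ e ∈ N.E, ¬ N.IsLoop e) {r : ℕ}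
    (hR : N.eRank = (r : ℕ∞)) (hn : N.E.ncard < 2 * r) :
    ∃ e ∈ N.E, ∀ f ∈ N.E, f ≠ e → ¬ N.Dep {e, f} := by
  classical
  by_contra hcon
  push Not at hcon
  obtain ⟨B, hB⟩ := N.exists_isBase
  have hBE : B ⊆ N.E := hB.subset_ground
  have hBfin : B.Finite := N.ground_finite.subset hBE
  -- every basis element lies in the closure of the complement
  have hcl : B ⊆ N.closure (N.E \ B) := by
    intro b hb
    obtain ⟨f, hf, hfb, hdep⟩ := hcon b (hBE hb)
    have hfB : f ∉ B := by
      intro hfB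
      exact hdep.not_indep (hB.indep.subset (Set.pair_subset hb hfB))
    have hfnl : N.IsNonloop f := (Matroid.not_isLoop_iff hf).1 (hL f hf)
    have hbcl : b ∈ N.closure {f} := by
      rw [hfnl.indep.mem_closure_iff]
      left
      rw [Set.insert_eq]
      convert hdep using 1
      ext x; simp [or_comm]
    have hfmem : f ∈ N.E \ B := ⟨hf, hfB⟩
    exact N.closure_subset_closure (Set.singleton_subset_iff.2 hfmem) hbcl
  have hsp : N.Spanning (N.E \ B) := by
    rw [Matroid.spanning_iff_ground_subset_closure Set.sdiff_subset]
    have h1 : N.E ⊆ N.closure B := by rw [hB.closure_eq]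
    have h2 : N.closure B ⊆ N.closure (N.E \ B) := N.closure_subset_closure_of_subset_closure hcl
    exact h1.trans h2
  have h1 : N.eRank ≤ (N.E \ B).encard := by
    rw [← hsp.eRk_eq]
    exact N.eRk_le_encard _
  have h2 : (N.E \ B).ncard + B.ncard = N.E.ncard := Set.ncard_sdiff_add_ncard_of_subset hBE N.ground_finite
  have h3 : B.ncard = r := by
    have := hB.encard_eq_eRank
    rw [hR, ← hBfin.cast_ncard_eq] at this
    exact_mod_cast this
  have h4 : r ≤ (N.E \ B).ncard := by
    rw [hR, ← N.ground_finite.sdiff.cast_ncard_eq] at h1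
    exact_mod_cast h1
  omega

/-- Deleting a non-coloop lowers the dual rank by one. -/
theorem eRank_dual_delete_singleton (N : Matroid α) [N.Finite] {ν : ℕ} (hν : N✶.eRank = ((ν + 1 : ℕ) : ℕ∞))
    {e : α} (he : e ∈ N.E) (hec : ¬ N.IsColoop e) : (N ＼ {e})✶.eRank = (ν : ℕ∞) := by
  have hsp : N.Spanning (N.E \ {e}) := by
    by_contra h
    exact hec (Matroid.isColoop_iff_sdiff_not_spanning.2 h)
  have h1 : (N ＼ {e}).eRank = N.eRank := by
    rw [Matroid.delete_eq_restrict, Matroid.eRank_restrict, hsp.eRk_eq]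
  have h2 := (N ＼ {e}).eRank_add_eRank_dual
  rw [Matroid.delete_ground, h1] at h2
  have h3 := N.eRank_add_eRank_dual
  have h4 : (N.E \ {e}).encard + 1 = N.E.encard := Set.encard_sdiff_singleton_add_one he
  have hRfin : N.eRank ≠ ⊤ := (N.eRank_le_encard_ground.trans_lt N.ground_finite.encard_lt_top).ne
  have key : N.eRank + (N ＼ {e})✶.eRank + 1 = N.eRank + (ν : ℕ∞) + 1 := by
    rw [h2, h4, ← h3, hν]
    push_cast
    ring
  have key' : (N ＼ {e})✶.eRank + 1 = (ν : ℕ∞) + 1 := by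
    have := key
    rw [add_assoc, add_assoc] at this
    exact WithTop.add_left_cancel hRfin this
  exact WithTop.add_right_cancel (WithTop.one_ne_top) key'

/-- Contracting a non-loop keeps the dual rank. -/
theorem eRank_dual_contract_singleton (N : Matroid α) [N.Finite] {ν : ℕ} (hν : N✶.eRank = (ν : ℕ∞))
    {e : α} (he : e ∈ N.E) (hel : ¬ N.IsLoop e) : (N ／ {e})✶.eRank = (ν : ℕ∞) := by
  have h := eRank_dual_contract_add N (Set.singleton_subset_iff.2 he)
  have hnl : N.IsNonloop e := (Matroid.not_isLoop_iff he).1 hel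
  rw [hnl.eRk_eq, add_comm (1 : ℕ∞), Set.encard_sdiff_singleton_add_one he, ← N.eRank_add_eRank_dual, hν,
    add_comm N.eRank] at h
  have hRfin : N.eRank ≠ ⊤ := (N.eRank_le_encard_ground.trans_lt N.ground_finite.encard_lt_top).ne
  exact WithTop.add_right_cancel hRfin h

/-- **The nullity of a subset is at most the nullity of the matroid**: `|X| ≤ ρ(X) + ν` for `X ⊆ E`. -/
theorem encard_le_eRk_add_of_dual_eRank (N : Matroid α) [N.Finite] {ν : ℕ} (hν : N✶.eRank = (ν : ℕ∞))
    {X : Set α} (hX : X ⊆ N.E) : X.encard ≤ N.eRk X + ν := by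
  have h2 : N.eRk N.E ≤ N.eRk X + (N.E \ X).encard := by
    calc N.eRk N.E = N.eRk (X ∪ (N.E \ X)) := by rw [Set.union_sdiff_cancel hX]
      _ ≤ N.eRk X + (N.E \ X).encard := N.eRk_union_le_eRk_add_encard _ _
  have h3 : (N.E \ X).encard + X.encard = N.E.encard := Set.encard_sdiff_add_encard_of_subset hX
  have h5 : N.eRank + N✶.eRank = N.E.encard := N.eRank_add_eRank_dual
  have hRfin : N.eRank ≠ ⊤ := (N.eRank_le_encard_ground.trans_lt N.ground_finite.encard_lt_top).ne
  have key : X.encard + N.eRank ≤ N.eRk X + ν + N.eRank := by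
    calc X.encard + N.eRank = X.encard + N.eRk N.E := by rw [Matroid.eRank_def]
      _ ≤ X.encard + (N.eRk X + (N.E \ X).encard) := by gcongr
      _ = N.eRk X + ((N.E \ X).encard + X.encard) := by ring
      _ = N.eRk X + (N.eRank + N✶.eRank) := by rw [h3, h5]
      _ = N.eRk X + ν + N.eRank := by rw [hν]; ring
  exact (ENat.add_le_add_iff_right hRfin).1 key

/-- **The dependent pairs through one deletion**: if `e` (a non-coloop) is in no `2`-circuit, the dependent pairs of `N` are those of
`N ＼ e`, at most `C(ν + 1, 2)` when `N✶.eRank = ν + 1`. -/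
theorem ncard_dep_two_le_of_forall_indep_pair (N : Matroid α) [N.Finite] {ν : ℕ} (hν : N✶.eRank = ((ν + 1 : ℕ) : ℕ∞))
    (hL : ∀ e ∈ N.E, ¬ N.IsLoop e) {e : α} (he : e ∈ N.E) (hec : ¬ N.IsColoop e)
    (he2 : ∀ f ∈ N.E, f ≠ e → ¬ N.Dep {e, f}) :
    {X : Set α | X ⊆ N.E ∧ X.ncard = 2 ∧ N.Dep X}.ncard ≤ (ν + 1).choose 2 := by
  have hν' := eRank_dual_delete_singleton N hν he hec
  have hL' : ∀ f ∈ (N ＼ {e}).E, ¬ (N ＼ {e}).IsLoop f := by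
    intro f hf hfl
    rw [Matroid.delete_isLoop_iff] at hfl
    exact hL f (Matroid.delete_subset_ground N {e} hf) hfl.1
  have hsub : {X : Set α | X ⊆ N.E ∧ X.ncard = 2 ∧ N.Dep X} ⊆
      {X : Set α | X ⊆ (N ＼ {e}).E ∧ X.ncard = 2 ∧ (N ＼ {e}).Dep X} := by
    rintro X ⟨hXE, hX2, hXdep⟩
    have heX : e ∉ X := by
      intro heX
      obtain ⟨x, y, hxy, rfl⟩ := Set.ncard_eq_two.1 hX2
      rcases heX with rfl | heX
      · exact he2 y (hXE (Set.mem_insert_of_mem _ (Set.mem_singleton y))) hxy.symm hXdep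
      · rw [Set.mem_singleton_iff] at heX
        subst heX
        refine he2 x (hXE (Set.mem_insert x _)) hxy ?_
        convert hXdep using 1
        exact Set.pair_comm _ _
    refine ⟨?_, hX2, ?_⟩
    · rw [Matroid.delete_ground]
      exact Set.subset_sdiff_singleton hXE heX
    · rw [Matroid.delete_dep_iff]
      exact ⟨hXdep, Set.disjoint_singleton_right.2 heX⟩
  exact (Set.ncard_le_ncard hsub ((N ＼ {e}).ground_finite.finite_subsets.subset (fun X hX => hX.1))).trans
    (ncard_dep_two_le (N ＼ {e}) hν' hL')

/-- **The dependent triples through one deletion**: if `e` is in no `2`-circuit, a dependent triple avoids `e` (a dependent triple of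
`N ＼ e`), or is `e` plus a dependent pair, or is a `3`-circuit through `e` (whose image in `N ／ e` is a `2`-circuit). -/
theorem ncard_dep_three_le_of_forall_indep_pair (N : Matroid α) [N.Finite]
    (hL : ∀ e ∈ N.E, ¬ N.IsLoop e) {e : α}
    (he2 : ∀ f ∈ N.E, f ≠ e → ¬ N.Dep {e, f}) :
    {X : Set α | X ⊆ N.E ∧ X.ncard = 3 ∧ N.Dep X}.ncard ≤
      {X : Set α | X ⊆ (N ＼ {e}).E ∧ X.ncard = 3 ∧ (N ＼ {e}).Dep X}.ncard +
        {X : Set α | X ⊆ N.E ∧ X.ncard = 2 ∧ N.Dep X}.ncard +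
          {C : Set α | (N ／ {e}).IsCircuit C ∧ C.ncard = 2}.ncard := by
  classical
  set A := {X : Set α | X ⊆ (N ＼ {e}).E ∧ X.ncard = 3 ∧ (N ＼ {e}).Dep X} with hA
  set B := (fun Y : Set α => insert e Y) '' {X : Set α | X ⊆ N.E ∧ X.ncard = 2 ∧ N.Dep X} with hB
  set C := (fun Y : Set α => insert e Y) '' {C : Set α | (N ／ {e}).IsCircuit C ∧ C.ncard = 2} with hC
  have hcover : {X : Set α | X ⊆ N.E ∧ X.ncard = 3 ∧ N.Dep X} ⊆ A ∪ B ∪ C := by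
    rintro X ⟨hXE, hX3, hXdep⟩
    have hXfin : X.Finite := N.ground_finite.subset hXE
    by_cases heX : e ∈ X
    · -- `X = insert e Y`
      set Y := X \ {e} with hY
      have hXY : X = insert e Y := by
        rw [hY, Set.insert_sdiff_singleton, Set.insert_eq_of_mem heX]
      have hYE : Y ⊆ N.E := Set.sdiff_subset.trans hXE
      have hY2 : Y.ncard = 2 := by
        rw [hY, Set.ncard_sdiff_singleton_of_mem heX, hX3]
      have heY : e ∉ Y := fun h => h.2 rfl
      by_cases hYdep : N.Dep Y
      · exact Or.inl (Or.inr ⟨Y, ⟨hYE, hY2, hYdep⟩, hXY.symm⟩)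
      · -- `X` is a `3`-circuit through `e`
        have hYind : N.Indep Y := by
          by_contra hni
          exact hYdep ⟨hni, hYE⟩
        have hXc : N.IsCircuit X := by
          obtain ⟨D, hDX, hD⟩ := hXdep.exists_isCircuit_subset
          have hDfin : D.Finite := hXfin.subset hDX
          have hD3 : D.ncard ≤ 3 := by
            have := Set.ncard_le_ncard hDX hXfin
            omega
          have hD1 : D.ncard ≠ 1 := by
            intro h1
            obtain ⟨x, rfl⟩ := Set.ncard_eq_one.1 h1
            exact hL x (hD.subset_ground (Set.mem_singleton x)) (Matroid.singleton_isCircuit.1 hD)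
          have hD0 : D.ncard ≠ 0 := by
            intro h0
            rw [Set.ncard_eq_zero hDfin] at h0
            exact hD.nonempty.ne_empty h0
          have hD2 : D.ncard ≠ 2 := by
            intro h2
            by_cases heD : e ∈ D
            · obtain ⟨x, y, hxy, hDxy⟩ := Set.ncard_eq_two.1 h2
              have hxX : x ∈ X := hDX (hDxy ▸ Set.mem_insert x _)
              have hyX : y ∈ X := hDX (hDxy ▸ Set.mem_insert_of_mem x (Set.mem_singleton y))
              rw [hDxy] at heD
              rcases heD with rfl | heD
              · exact he2 y (hXE hyX) hxy.symm (hDxy ▸ hD.dep)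
              · rw [Set.mem_singleton_iff] at heD
                subst heD
                refine he2 x (hXE hxX) hxy ?_
                have := hD.dep
                rw [hDxy, Set.pair_comm] at this
                exact this
            · have hDY : D ⊆ Y := fun x hx => ⟨hDX hx, fun hxe => heD (hxe ▸ hx)⟩
              exact hD.dep.not_indep (hYind.subset hDY)
          have hDeq : D = X := Set.eq_of_subset_of_ncard_le hDX (by omega) hXfin
          exact hDeq ▸ hD
        have hnt : X.Nontrivial :=
          (Set.one_lt_ncard_iff_nontrivial_and_finite.1 (by rw [hX3]; norm_num)).1
        have hC' : (N ／ {e}).IsCircuit (X \ {e}) := hXc.contractElem_isCircuit hnt heX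
        exact Or.inr ⟨Y, ⟨hC', hY2⟩, hXY.symm⟩
    · refine Or.inl (Or.inl ⟨?_, hX3, ?_⟩)
      · rw [Matroid.delete_ground]
        exact Set.subset_sdiff_singleton hXE heX
      · rw [Matroid.delete_dep_iff]
        exact ⟨hXdep, Set.disjoint_singleton_right.2 heX⟩
  have hAfin : A.Finite := (N ＼ {e}).ground_finite.finite_subsets.subset (fun X hX => hX.1)
  have hBfin : B.Finite := (N.ground_finite.finite_subsets.subset (fun X hX => hX.1)).image _
  have hCfin : C.Finite := ((N ／ {e}).ground_finite.finite_subsets.subset (fun C hC => hC.1.subset_ground)).image _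
  calc {X : Set α | X ⊆ N.E ∧ X.ncard = 3 ∧ N.Dep X}.ncard ≤ (A ∪ B ∪ C).ncard :=
        Set.ncard_le_ncard hcover ((hAfin.union hBfin).union hCfin)
    _ ≤ (A ∪ B).ncard + C.ncard := Set.ncard_union_le _ _
    _ ≤ A.ncard + B.ncard + C.ncard := by gcongr; exact Set.ncard_union_le _ _
    _ ≤ _ := by
        have hB' : B.ncard ≤ {X : Set α | X ⊆ N.E ∧ X.ncard = 2 ∧ N.Dep X}.ncard :=
          Set.ncard_image_le (N.ground_finite.finite_subsets.subset (fun X (hX : X ⊆ N.E ∧ X.ncard = 2 ∧ N.Dep X) => hX.1))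
        have hC' : C.ncard ≤ {C : Set α | (N ／ {e}).IsCircuit C ∧ C.ncard = 2}.ncard :=
          Set.ncard_image_le ((N ／ {e}).ground_finite.finite_subsets.subset
            (fun C (hC : (N ／ {e}).IsCircuit C ∧ C.ncard = 2) => hC.1.subset_ground))
        omega

end S2

end PercRepro
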